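import Summits.CriticalPhenomena.PercolationContinuityZ3.Theorems.SahiCMTP2Basic

/-!
# Density-free cMTP₂ (Fuchs–Wang 2026, (5.1)) in the paper's coordinates: a law on `ℝ^δ` and a partition `A ⊔ B`

Support file of the Sahi cell (`prim-sahi`, typer seat, generation 18; `--supports stmt-CriticalPhenomena-4575`).
Theorems only (no definitions, no named facts, no sorries).

`Literature.Probability.LatticeModels.IsCMTP2SetAt p μ` is (5.1) for the law `μ` of `X = (X_i)_{i∈δ}` and the partition
`A = {i | p i}`, `B = {i | ¬ p i}`, i.e. `IsCMTP2Set` of the law of `(X_A, X_B)` (transport along the coordinate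
regrouping `e = MeasurableEquiv.piEquivPiSubtypeProd`).  Since `e` is an order isomorphism (`piEquivPiSubtypeProd_le_iff`,
`preimage_piEquivPiSubtypeProd_Iic`), the block-form theorems translate verbatim:

* `isCMTP2SetAt_of_mIsSetTP2` — density-free MTP₂ of `X` (Colangelo–Müller–Scarsini Def. 2) ⟹ `cMTP₂^set(X_B|X_A)` for
  EVERY partition (density-free [FuchsWang2026] Cor. 2.11 (1)).
* `isCdfMTP2_of_isCMTP2SetAt` — `cMTP₂^set(X_B|X_A)` for SOME partition ⟹ MTP₂ of the distribution function of `X`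
  (density-free Cor. 2.11 (3) / Thm. 2.5 (2)).

(The closure theorem in these coordinates is `SahiCMTP2WeakLimits.isCMTP2SetAt_of_tendsto`.)  No sorries, no new axioms.
-/

noncomputable section

namespace Summit.CriticalPhenomena.PercolationContinuityZ3.Theorems.SahiCMTP2

open MeasureTheory Set Filter Topology Function
open Literature.Probability.LatticeModels Literature.Probability.LatticeModels.Affiliation
open scoped ENNReal SetFamily

section Regroup

variable {δ : Type*} {α : Type*} [MeasurableSpace α] [Lattice α] (p : δ → Prop) [DecidablePred p]

/-- The coordinate regrouping is an order embedding: `x ≤ e⁻¹ q ↔ e x ≤ q`. [folklore] -/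
theorem le_piEquivPiSubtypeProd_symm_iff (x : δ → α) (q : ({i // p i} → α) × ({i // ¬ p i} → α)) :
    x ≤ (MeasurableEquiv.piEquivPiSubtypeProd (fun _ : δ => α) p).symm q ↔
      MeasurableEquiv.piEquivPiSubtypeProd (fun _ : δ => α) p x ≤ q := by
  simp only [Pi.le_def, Prod.le_def, MeasurableEquiv.piEquivPiSubtypeProd_apply,
    MeasurableEquiv.piEquivPiSubtypeProd_symm_apply]
  constructor
  · intro h
    refine ⟨fun i => ?_, fun i => ?_⟩
    · have hi := h i; rw [dif_pos i.2] at hi; exact hi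
    · have hi := h i; rw [dif_neg i.2] at hi; exact hi
  · rintro ⟨h₁, h₂⟩ i
    by_cases hi : p i
    · rw [dif_pos hi]; exact h₁ ⟨i, hi⟩
    · rw [dif_neg hi]; exact h₂ ⟨i, hi⟩

/-- Preimages of lower orthants under the regrouping are lower orthants. [folklore] -/
theorem preimage_piEquivPiSubtypeProd_Iic (q : ({i // p i} → α) × ({i // ¬ p i} → α)) :
    MeasurableEquiv.piEquivPiSubtypeProd (fun _ : δ => α) p ⁻¹' Iic q =
      Iic ((MeasurableEquiv.piEquivPiSubtypeProd (fun _ : δ => α) p).symm q) := by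
  ext x
  rw [mem_preimage, mem_Iic, mem_Iic, le_piEquivPiSubtypeProd_symm_iff]

/-- In particular `e⁻¹(−∞, e x] = (−∞, x]`. [folklore] -/
theorem preimage_piEquivPiSubtypeProd_Iic_apply (x : δ → α) :
    MeasurableEquiv.piEquivPiSubtypeProd (fun _ : δ => α) p ⁻¹'
        Iic (MeasurableEquiv.piEquivPiSubtypeProd (fun _ : δ => α) p x) = Iic x := by
  rw [preimage_piEquivPiSubtypeProd_Iic, MeasurableEquiv.symm_apply_apply]

/-- The regrouping commutes with `⊓`. [folklore] -/
theorem piEquivPiSubtypeProd_inf (x y : δ → α) :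
    MeasurableEquiv.piEquivPiSubtypeProd (fun _ : δ => α) p (x ⊓ y) =
      MeasurableEquiv.piEquivPiSubtypeProd (fun _ : δ => α) p x ⊓
        MeasurableEquiv.piEquivPiSubtypeProd (fun _ : δ => α) p y := rfl

/-- The regrouping commutes with `⊔`. [folklore] -/
theorem piEquivPiSubtypeProd_sup (x y : δ → α) :
    MeasurableEquiv.piEquivPiSubtypeProd (fun _ : δ => α) p (x ⊔ y) =
      MeasurableEquiv.piEquivPiSubtypeProd (fun _ : δ => α) p x ⊔
        MeasurableEquiv.piEquivPiSubtypeProd (fun _ : δ => α) p y := rfl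

end Regroup

section Real

variable {δ : Type*} [Fintype δ] (p : δ → Prop) [DecidablePred p]

/-- **Density-free MTP₂ of `X` ⟹ `cMTP₂^set(X_B|X_A)` for every partition** (density-free [FuchsWang2026] Cor. 2.11 (1) /
Thm. 2.5 (1), in the paper's coordinates). [this work] -/
theorem isCMTP2SetAt_of_mIsSetTP2 {μ : Measure (δ → ℝ)} (hμ : mIsSetTP2 μ) : IsCMTP2SetAt p μ :=
  isCMTP2Set_of_mIsSetTP2
    (hμ.map_of_map_sup_inf (MeasurableEquiv.piEquivPiSubtypeProd (fun _ : δ => ℝ) p).measurable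
      (piEquivPiSubtypeProd_sup p) (piEquivPiSubtypeProd_inf p))

/-- **`cMTP₂^set(X_B|X_A)` for some partition ⟹ MTP₂ of the distribution function of `X`** (density-free
[FuchsWang2026] Cor. 2.11 (3) / Thm. 2.5 (2), in the paper's coordinates). [this work] -/
theorem isCdfMTP2_of_isCMTP2SetAt {μ : Measure (δ → ℝ)} (h : IsCMTP2SetAt p μ) : IsCdfMTP2 μ := by
  intro x y
  have h1 := isCdfMTP2_of_isCMTP2Set h (MeasurableEquiv.piEquivPiSubtypeProd (fun _ : δ => ℝ) p x)
    (MeasurableEquiv.piEquivPiSubtypeProd (fun _ : δ => ℝ) p y)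
  rwa [← piEquivPiSubtypeProd_inf, ← piEquivPiSubtypeProd_sup, MeasurableEquiv.map_apply,
    MeasurableEquiv.map_apply, MeasurableEquiv.map_apply, MeasurableEquiv.map_apply,
    preimage_piEquivPiSubtypeProd_Iic_apply, preimage_piEquivPiSubtypeProd_Iic_apply,
    preimage_piEquivPiSubtypeProd_Iic_apply, preimage_piEquivPiSubtypeProd_Iic_apply] at h1

/-- **`cMTP₂^set(X_B|X_A)` ⟹ `LTD(X_B|X_A)`** in the paper's coordinates (density-free Thm. 2.8 (2)). [this work] -/
theorem isLTD_of_isCMTP2SetAt {μ : Measure (δ → ℝ)} (h : IsCMTP2SetAt p μ) :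
    IsLTD (μ.map (MeasurableEquiv.piEquivPiSubtypeProd (fun _ : δ => ℝ) p)) :=
  isLTD_of_isCMTP2Set_pi_real h

end Real

end Summit.CriticalPhenomena.PercolationContinuityZ3.Theorems.SahiCMTP2
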